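import Literature.MathematicalPhysics.QuantumFieldTheory.Balaban1983to89.T3Thresholds
import Literature.MathematicalPhysics.QuantumFieldTheory.Balaban1983to89.T3MinimiserStabilityReduction
import Mathlib.Analysis.SpecialFunctions.Pow.Real
import HarnessLib

/-!
# Rate bricks for the DECAY row of LINE g18-1: exponent matching, corner-independence of the 4-point, `J·θ_J² → 0`

`ym-ust-20520-w4` g15; def-free helper of the crux `stmt-QuantumFields-20520` (`--supports`, NOT a proof of it).  LINE g18-1
`Cruxes/FluctuationComparisonRegPrIntL/Lines/semiclassical_s2beta.lean` (v10.1) displays FOUR-POINT-DECAY — the κ-clustering of the 4-point of the logs of the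
per-corner scaled Laplace LIMIT VALUES `ℓ_x` (`λ^{d∕2}·G_x(λ) → ℓ_x`).  Any supplier that computes those limits in a determinant form `λ^{d′∕2}·G_x(λ) → e^{E_x}`
(common-tube ∕ Faddeev–Popov, w5-20520 g14 ∕ px19 g10's v11 letters) needs three scale-free bricks, landed here BY NAME:

* ★ `tendsto_rpow_sub_of_two_limits` — two power-scaled limits of one eventually non-vanishing function force `λ^{(d−d′)∕2} → a∕a′`;
* ★ `fourPt_log_eq_of_matched_limits` — at four corners, `λ^{d∕2}G_x → ℓ_x > 0` and `λ^{d′∕2}G_x → e^{E_x}` ⇒ `(log ℓU − log ℓV) − (log ℓW − log ℓZ) =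
  (EU − EV) − (EW − EZ)` (the common factor `lim λ^{(d−d′)∕2}` cancels in the 4-point, by uniqueness of limits);
* ★ `tendsto_mul_θBal_sq` — `J · (c·θBal_J²) → 0` (✓`T3Thresholds.θBal_le_const_mul_sqrt_coupling`: `θ_J ≤ A·(γ L^{−J})^{1∕4}`), the `J·φ₁ J → 0` clause of
  1L4ᶜ for every `φ₁ J = O(θ_J²)` rate.

HONEST: real analysis; proves no stub of the line (EXW, GAP♯, FOUR-POINT-DECAY, H4ᶜ, LFR♯ᶜ), nothing of S2β or the crux 20520; no summit is proved by a helper;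
rung R3 (YM₃ on T³) is NOT d = 4, NOT infinite volume, NOT a mass gap, NOT Clay; the Yang–Mills mass gap is NOT proved.  Def-free; default heartbeats.
-/

noncomputable section

open Filter Topology
open Literature.MathematicalPhysics.QuantumFieldTheory.Balaban1983to89
open Literature.MathematicalPhysics.QuantumFieldTheory.Balaban1983to89.T3ContinuumYM3Torus
open Literature.MathematicalPhysics.QuantumFieldTheory.Balaban1983to89.T3UnitScaleTilt

namespace Summit.QuantumFields.YangMills.Theorems.FluctuationComparisonRegPrIntLS2BetaDecayRates

/-- The exponent-matching lemma: two power-scaled limits of one eventually non-vanishing function force the power ratio to converge to the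
ratio of the limits. [cite: Balaban1985Variational, Thm 1 (8) p.279] -/
theorem tendsto_rpow_sub_of_two_limits {G : ℝ → ℝ} {d d' a a' : ℝ}
    (h : Tendsto (fun lam : ℝ => lam ^ (d / 2) * G lam) atTop (𝓝 a))
    (h' : Tendsto (fun lam : ℝ => lam ^ (d' / 2) * G lam) atTop (𝓝 a')) (ha' : 0 < a') :
    Tendsto (fun lam : ℝ => lam ^ ((d - d') / 2)) atTop (𝓝 (a / a')) := by
  have hne : ∀ᶠ lam : ℝ in atTop, lam ^ (d' / 2) * G lam ≠ 0 :=
    (h'.eventually (lt_mem_nhds ha')).mono fun lam hl => ne_of_gt hl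
  refine (h.div h' ha'.ne').congr' ?_
  filter_upwards [hne, eventually_gt_atTop (0 : ℝ)] with lam hl hlam
  have hG : G lam ≠ 0 := fun h0 => hl (by rw [h0, mul_zero])
  simp only [Pi.div_apply]
  rw [mul_div_mul_right _ _ hG, ← Real.rpow_sub hlam]
  congr 1
  ring

/-- ★ **CORNER-INDEPENDENCE OF THE 4-POINT UNDER EXPONENT MATCHING**: if at four corners the same functions have power-scaled limits
`λ^{d∕2}·G_x → ℓ_x > 0` and `λ^{d′∕2}·G_x → e^{E_x}`, then `λ^{(d−d′)∕2}` converges to `ℓ_x e^{−E_x}` at every corner, so these four numbers coincide and the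
4-points of `log ℓ` and of `E` are equal. [cite: Balaban1985Variational, Thm 1 (8)-(10) p.279] -/
theorem fourPt_log_eq_of_matched_limits {X : Type*} {G : X → ℝ → ℝ} {d d' : ℝ} {ℓ E : X → ℝ} {U V W Z : X}
    (hℓ : ∀ x, x = U ∨ x = V ∨ x = W ∨ x = Z → 0 < ℓ x ∧ Tendsto (fun lam : ℝ => lam ^ (d / 2) * G x lam) atTop (𝓝 (ℓ x)))
    (hE : ∀ x, x = U ∨ x = V ∨ x = W ∨ x = Z → Tendsto (fun lam : ℝ => lam ^ (d' / 2) * G x lam) atTop (𝓝 (Real.exp (E x)))) :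
    (Real.log (ℓ U) - Real.log (ℓ V)) - (Real.log (ℓ W) - Real.log (ℓ Z)) = (E U - E V) - (E W - E Z) := by
  have q : ∀ x, x = U ∨ x = V ∨ x = W ∨ x = Z → Tendsto (fun lam : ℝ => lam ^ ((d - d') / 2)) atTop (𝓝 (ℓ x / Real.exp (E x))) :=
    fun x hx => tendsto_rpow_sub_of_two_limits (hℓ x hx).2 (hE x hx) (Real.exp_pos _)
  have hU : U = U ∨ U = V ∨ U = W ∨ U = Z := Or.inl rfl
  have hV : V = U ∨ V = V ∨ V = W ∨ V = Z := Or.inr (Or.inl rfl)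
  have hW : W = U ∨ W = V ∨ W = W ∨ W = Z := Or.inr (Or.inr (Or.inl rfl))
  have hZ : Z = U ∨ Z = V ∨ Z = W ∨ Z = Z := Or.inr (Or.inr (Or.inr rfl))
  have logeq : ∀ {x y : X}, (x = U ∨ x = V ∨ x = W ∨ x = Z) → (y = U ∨ y = V ∨ y = W ∨ y = Z) →
      Real.log (ℓ x) - E x = Real.log (ℓ y) - E y := by
    intro x y hx hy
    have h := congrArg Real.log (tendsto_nhds_unique (q x hx) (q y hy))
    rwa [Real.log_div (hℓ x hx).1.ne' (Real.exp_pos _).ne', Real.log_div (hℓ y hy).1.ne' (Real.exp_pos _).ne', Real.log_exp,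
      Real.log_exp] at h
  have kV := logeq hU hV
  have kW := logeq hU hW
  have kZ := logeq hU hZ
  linarith

/-- `J · θ_J² → 0` along Bałaban's thresholds (`θ_J ≤ A·(γ L^{−J})^{1∕4}`, ✓`T3Thresholds.θBal_le_const_mul_sqrt_coupling`).
[cite: Balaban1985UV3, (3) p.256 and (7) p.257] -/
theorem tendsto_mul_θBal_sq (F : T3Family) {γ : ℝ} (hγ : 0 < γ) (hγ1 : γ ≤ 1) {b₀ p₀ : ℝ} (hb : 0 < b₀) (hp : 0 < p₀) (c : ℝ) :
    Tendsto (fun J : ℕ => (J : ℝ) * (c * θBal F.L γ b₀ p₀ J ^ 2)) atTop (𝓝 0) := by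
  have hL1 : 1 ≤ F.L := F.hL.2.le
  have hLr : (1 : ℝ) < F.L := by exact_mod_cast F.hL.2
  set A : ℝ := b₀ * ((2 * p₀) ^ p₀ * Real.exp (1 / 2 - p₀)) with hA
  set q : ℝ := Real.sqrt ((F.L : ℝ)⁻¹) with hq
  have hq0 : 0 ≤ q := Real.sqrt_nonneg _
  have hLinv0 : 0 ≤ ((F.L : ℝ)⁻¹) := inv_nonneg.2 (by positivity)
  have hq1 : q < 1 := by
    rw [hq, Real.sqrt_lt' one_pos, one_pow]
    exact inv_lt_one_of_one_lt₀ hLr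
  have hqsq : ∀ J : ℕ, ((F.L : ℝ)⁻¹) ^ J = (q ^ J) ^ 2 := fun J => by
    rw [← pow_mul, mul_comm, pow_mul, hq, Real.sq_sqrt hLinv0]
  have hθ0 : ∀ J, 0 ≤ θBal F.L γ b₀ p₀ J := fun J =>
    (Literature.MathematicalPhysics.QuantumFieldTheory.Balaban1983to89.T3MinimiserStabilityReduction.θBal_pos hL1 hγ hγ1 hb p₀ J).le
  have hθle : ∀ J : ℕ, θBal F.L γ b₀ p₀ J ^ 2 ≤ A ^ 2 * Real.sqrt γ * q ^ J := by
    intro J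
    have h := Literature.MathematicalPhysics.QuantumFieldTheory.Balaban1983to89.T3Thresholds.θBal_le_const_mul_sqrt_coupling (b₀ := b₀) (p₀ := p₀) hL1 hγ hγ1 hb.le hp J
    have hsq : θBal F.L γ b₀ p₀ J ^ 2 ≤ (A * Real.sqrt (Real.sqrt (γ * ((F.L : ℝ)⁻¹) ^ J))) ^ 2 :=
      pow_le_pow_left₀ (hθ0 J) h 2
    refine hsq.trans (le_of_eq ?_)
    rw [mul_pow, Real.sq_sqrt (Real.sqrt_nonneg _), Real.sqrt_mul hγ.le, hqsq, Real.sqrt_sq (pow_nonneg hq0 _), mul_assoc]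
  have hmain : Tendsto (fun J : ℕ => (J : ℝ) * θBal F.L γ b₀ p₀ J ^ 2) atTop (𝓝 0) := by
    have hgeo : Tendsto (fun J : ℕ => A ^ 2 * Real.sqrt γ * ((J : ℝ) * q ^ J)) atTop (𝓝 0) := by
      have h := (tendsto_self_mul_const_pow_of_lt_one hq0 hq1).const_mul (A ^ 2 * Real.sqrt γ)
      rw [mul_zero] at h
      exact h
    refine squeeze_zero (fun J => by positivity) (fun J => ?_) hgeo
    calc (J : ℝ) * θBal F.L γ b₀ p₀ J ^ 2 ≤ (J : ℝ) * (A ^ 2 * Real.sqrt γ * q ^ J) :=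
          mul_le_mul_of_nonneg_left (hθle J) (Nat.cast_nonneg J)
      _ = A ^ 2 * Real.sqrt γ * ((J : ℝ) * q ^ J) := by ring
  have h := hmain.const_mul c
  rw [mul_zero] at h
  refine h.congr fun J => ?_
  ring

end Summit.QuantumFields.YangMills.Theorems.FluctuationComparisonRegPrIntLS2BetaDecayRates

end
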